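import Summits.ABC.StewartYu.PadicW80ParLF
import Summits.ABC.StewartYu.PadicW80Numeric
import HarnessLib

/-!
# The `(log p)`-normalised numerics: the two `k`-step inequalities in TRUE `log p` form

Support file (theorems only), cell `abc-stewartyu` (p1, stub S5 of memo-03 §4): twin of `PadicW80Numeric.lean`
on the `ℓ`-normalised record `PadicW80ParL`, instantiated at `ℓ = log p` (hypothesis `hℓp : P.ℓ = Real.log p`,
`p ≥ 3`). It discharges the two hypotheses of p2's `PadicCW77.Setup.kFinal_of_log_ineq` DIRECTLY — not through
the `p`-free `kFinal_of_pfree_ineq` (`log p ↦ log 3`), which is where the landed chain lost the factor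
`(log p)^{m+1}`:
* (1) smallness: `(⌊hL_b/(p−1)⌋ + ⌊(t−1)/(p−1)⌋ + cond)·log p + log(Dmax·Mmax) < U` — `hL_b·log p ≤ 𝔘/c_L + W⋆ + G`
  (`hparLbℓ_le`), `cond·log p ≤ kpts·t·log p/(p−1) + t log(2kpts) ≤ 2ᵏ𝔘/(p−1) + 𝔘/128` (`kpts·t ≤ 2ᵏ𝔘/log p`);
* (2) the Schwarz branch: `hL_b·log p + log(Dmax·Mmax) < (kpts·t/2)·log p` with `kpts·t·log p ≥ (31/32)·2ᵏ𝔘`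
  (`KT_ge`) against the budget `log(Dmax·Mmax) ≤ 𝔘/4 + 2ᵏ𝔘/16` — the SAME margin as the landed `p = 3` instance,
  now at every `p`.
The conditioning lemma `PadicW80Par.condSum_mul_log_le` is reused from the landed file.

## References
* [Waldschmidt1980] M. Waldschmidt, Acta Arith. 37 (1980), Lemmas 3.5–3.7 (pp. 271–273).
* [Yu1989] K. Yu, Acta Arith. 53 (1989), Lemma 1.4 (p. 117) — the Legendre conditioning.
* [Yu1990] K. Yu, Compositio Math. 74 (1990), (2.30)–(2.31) (p. 36) — the `(f log p)^{−(n+2)}` normalisation.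
-/

noncomputable section

open Finset Real

open Literature.NumberTheory.Transcendental Literature.NumberTheory.Transcendental.Waldschmidt1980

namespace Summit.ABC.StewartYu

open PadicW80Par (cTp cSp cLp cLp' Ap mRp condSum_mul_log_le)

namespace PadicW80ParL

variable {d : ℕ} (P : PadicW80ParL d)

/-! ### Elementary facts about `log p` -/

omit P in
/-- `log p ≤ p − 1`, i.e. `x·log p/(p−1) ≤ x`. [folklore] -/
private theorem log_le_sub_one_nat {p : ℕ} (hp : 2 ≤ p) : Real.log p ≤ (p : ℝ) - 1 :=
  Real.log_le_sub_one_of_pos (by exact_mod_cast (by omega : 0 < p))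

omit P in
/-- `1 ≤ log p` for `p ≥ 3` (`e < 3`). [folklore] -/
private theorem one_le_log_nat {p : ℕ} (hp : 3 ≤ p) : (1 : ℝ) ≤ Real.log p := by
  rw [Real.le_log_iff_exp_le (by exact_mod_cast (by omega : 0 < p))]
  have := Real.exp_one_lt_d9
  have h3 : (3 : ℝ) ≤ p := by exact_mod_cast hp
  linarith

/-! ### Small parameters against `𝔘` -/

/-- `t_J · log(2·kpts) ≤ 𝔘/128` for the nodes of any inner step (`kpts ≤ 2^{d+J₀} S₀`,
`2^{J₀} ≤ 2L_θ`, `L_θ S₀ ≤ 𝔘/2¹⁴`, `log 𝔘 ≤ log U ≤ 10 W⋆`, `T W⋆ ≤ 𝔘/c_T`). [folklore] -/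
theorem t_mul_log_kpts_le {J k : ℕ} (hJ : J < P.J₀ℓ) (hk : k ≤ d) :
    (P.tJℓ J : ℝ) * Real.log (2 * ((2 ^ (k + J) * P.S₀ℓ / 2 : ℕ) : ℝ)) ≤ P.𝔘ℓ / 128 := by
  have hkp := P.kpts_le_nat hJ.le hk
  have hLS := P.LθS₀_le
  have hpow : ((2 : ℕ) ^ P.J₀ℓ : ℝ) ≤ 2 * P.Lθℓ := by exact_mod_cast P.two_pow_le
  have hU := P.𝔘_pos; have hW := P.one_le_Wstar; have hWU := P.Wstar_le_𝔘
  have hT := P.T_pos; have hTW := P.TWstar_le; have hm := two_le_mR P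
  have hlogU := P.log_U_le
  -- `2 kpts ≤ 2 · 2^d · 2^{J₀} S₀ ≤ 2^{d+2} Lθ S₀ ≤ 2^{d+2} 𝔘/2^14 ≤ U`
  have h1 : 2 * ((2 ^ (k + J) * P.S₀ℓ / 2 : ℕ) : ℝ) ≤ P.Uℓ := by
    have hk' : ((2 ^ (k + J) * P.S₀ℓ / 2 : ℕ) : ℝ) ≤ ((2 ^ (d + P.J₀ℓ) * P.S₀ℓ : ℕ) : ℝ) := by
      exact_mod_cast hkp
    have hS : (0 : ℝ) ≤ P.S₀ℓ := P.S₀_pos.le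
    calc 2 * ((2 ^ (k + J) * P.S₀ℓ / 2 : ℕ) : ℝ) ≤ 2 * ((2 ^ (d + P.J₀ℓ) * P.S₀ℓ : ℕ) : ℝ) := by linarith
      _ = 2 * 2 ^ d * ((2 : ℕ) ^ P.J₀ℓ : ℝ) * P.S₀ℓ := by push_cast; ring
      _ ≤ 2 * 2 ^ d * (2 * P.Lθℓ) * P.S₀ℓ := by gcongr
      _ = 2 ^ (d + 2) * (P.Lθℓ * P.S₀ℓ) := by ring
      _ ≤ 2 ^ (d + 2) * (P.𝔘ℓ / 2 ^ 14) := by gcongr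
      _ ≤ 2 ^ (d + 1) * P.𝔘ℓ := by
          rw [show (2 : ℝ) ^ (d + 2) = 2 ^ (d + 1) * 2 by ring]
          have : (0 : ℝ) ≤ 2 ^ (d + 1) := by positivity
          nlinarith
      _ = P.Uℓ := P.U_eq.symm
  have hkpos : (0 : ℝ) < 2 * ((2 ^ (k + J) * P.S₀ℓ / 2 : ℕ) : ℝ) := by
    have hS2 := P.two_le_S₀
    have : 1 ≤ 2 ^ (k + J) * P.S₀ℓ / 2 := by
      rw [Nat.le_div_iff_mul_le two_pos]
      calc 1 * 2 = 2 := by ring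
        _ ≤ 2 ^ (k + J) * 2 := Nat.le_mul_of_pos_left 2 (Nat.pow_pos two_pos)
        _ ≤ 2 ^ (k + J) * P.S₀ℓ := Nat.mul_le_mul_left _ hS2
    have : (1 : ℝ) ≤ ((2 ^ (k + J) * P.S₀ℓ / 2 : ℕ) : ℝ) := by exact_mod_cast this
    linarith
  have hk1r : (1 : ℝ) ≤ 2 * ((2 ^ (k + J) * P.S₀ℓ / 2 : ℕ) : ℝ) := by
    have hS2 := P.two_le_S₀
    have : 1 ≤ 2 ^ (k + J) * P.S₀ℓ / 2 := by
      rw [Nat.le_div_iff_mul_le two_pos]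
      calc 1 * 2 = 2 := by ring
        _ ≤ 2 ^ (k + J) * 2 := Nat.le_mul_of_pos_left 2 (Nat.pow_pos two_pos)
        _ ≤ 2 ^ (k + J) * P.S₀ℓ := Nat.mul_le_mul_left _ hS2
    have : (1 : ℝ) ≤ ((2 ^ (k + J) * P.S₀ℓ / 2 : ℕ) : ℝ) := by exact_mod_cast this
    linarith
  have h2 : Real.log (2 * ((2 ^ (k + J) * P.S₀ℓ / 2 : ℕ) : ℝ)) ≤ 10 * P.Wstarℓ :=
    (Real.log_le_log hkpos h1).trans hlogU
  have ht : (P.tJℓ J : ℝ) ≤ P.Tℓ := by exact_mod_cast P.tJ_le_T J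
  have ht0 : (0 : ℝ) ≤ P.tJℓ J := Nat.cast_nonneg _
  calc (P.tJℓ J : ℝ) * Real.log (2 * ((2 ^ (k + J) * P.S₀ℓ / 2 : ℕ) : ℝ))
      ≤ P.Tℓ * (10 * P.Wstarℓ) := mul_le_mul ht h2 (Real.log_nonneg hk1r) hT.le
    _ = 10 * (P.Tℓ * P.Wstarℓ) := by ring
    _ ≤ 10 * (P.𝔘ℓ / cTp) := by gcongr
    _ ≤ P.𝔘ℓ / 128 := by unfold cTp; nlinarith

/-! ### The `k`-step inequalities (targets of `kFinal_of_log_ineq`) -/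

/-- **k-step, smallness branch (1)**: for `J < J₀`, `k < d`, `t = t_J`, `kpts = 2^{k+J}S₀/2`, `ℓ = log p` and
any size budget `log(Dmax·Mmax) ≤ 𝔘/4 + 2ᵏ𝔘/16`:
`(⌊hL_b/(p−1)⌋ + ⌊(t−1)/(p−1)⌋ + cond)·log p + log(Dmax·Mmax) < U` (the conditioning written out as in
`PadicCW77KStep.condExp`; `p ≥ 3`). [cite: Waldschmidt1980, Lemma 3.6 (p. 272)] [cite: Yu1990, (2.31) (p. 36)] -/
theorem kstep_ineq_one {p : ℕ} (hp : 3 ≤ p) (hℓp : P.ℓ = Real.log p) {J k : ℕ} (hJ : J < P.J₀ℓ) (hk : k < d)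
    {logDM : ℝ} (hDM : logDM ≤ P.𝔘ℓ / 4 + 2 ^ k * P.𝔘ℓ / 16) :
    ((P.hparℓ * P.Lbℓ / (p - 1) + (P.tJℓ J - 1) / (p - 1) +
        ∑ j ∈ range (Nat.log p (2 * (2 ^ (k + J) * P.S₀ℓ / 2))),
          P.tJℓ J * ((2 ^ (k + J) * P.S₀ℓ / 2) / p ^ (j + 1) + 1) : ℕ) : ℝ) * Real.log p + logDM <
      P.Uℓ := by
  have hp2 : 2 ≤ p := by omega
  have hp1 : (1 : ℝ) < p := by exact_mod_cast (by omega : 1 < p)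
  have hlogp1 := one_le_log_nat hp
  have hlogp0 : 0 ≤ Real.log p := by linarith
  have hlps := log_le_sub_one_nat hp2
  have hpm1 : (0 : ℝ) < (p : ℝ) - 1 := by linarith
  have hpm2 : (2 : ℝ) ≤ (p : ℝ) - 1 := by
    have : (3 : ℝ) ≤ p := by exact_mod_cast hp
    linarith
  have hU := P.𝔘_pos; have hW := P.one_le_Wstar; have hWU := P.Wstar_le_𝔘; have hGW := P.G_le_three_Wstar
  have hhLb := P.hparLbℓ_le; have hT := P.T_le_𝔘; have hTpos := P.T_pos
  have hKT := P.KT_le J k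
  have htl := P.t_mul_log_kpts_le hJ hk.le
  have hℓ := P.ℓ_pos
  set kpts : ℕ := 2 ^ (k + J) * P.S₀ℓ / 2 with hkpts
  set t : ℕ := P.tJℓ J with ht
  have hk1 : 1 ≤ kpts := by
    rw [hkpts, Nat.le_div_iff_mul_le two_pos]
    calc 1 * 2 = 2 := by ring
      _ ≤ 2 ^ (k + J) * 2 := Nat.le_mul_of_pos_left 2 (Nat.pow_pos two_pos)
      _ ≤ 2 ^ (k + J) * P.S₀ℓ := Nat.mul_le_mul_left _ P.two_le_S₀
  have htT : (t : ℝ) ≤ P.Tℓ := by exact_mod_cast P.tJ_le_T J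
  -- casts of the floor divisions
  have hc1 : ((P.hparℓ * P.Lbℓ / (p - 1) : ℕ) : ℝ) ≤ (P.hparℓ : ℝ) * P.Lbℓ / ((p : ℝ) - 1) := by
    have h := Nat.cast_div_le (α := ℝ) (m := P.hparℓ * P.Lbℓ) (n := p - 1)
    have e : ((p - 1 : ℕ) : ℝ) = (p : ℝ) - 1 := by rw [Nat.cast_sub (by omega)]; simp
    rw [e] at h; push_cast at h; exact h
  have hc2 : (((t - 1) / (p - 1) : ℕ) : ℝ) ≤ (t : ℝ) / ((p : ℝ) - 1) := by
    have h := Nat.cast_div_le (α := ℝ) (m := t - 1) (n := p - 1)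
    have e : ((p - 1 : ℕ) : ℝ) = (p : ℝ) - 1 := by rw [Nat.cast_sub (by omega)]; simp
    rw [e] at h
    have h2 : ((t - 1 : ℕ) : ℝ) ≤ t := by exact_mod_cast Nat.sub_le t 1
    exact h.trans (div_le_div_of_nonneg_right h2 hpm1.le)
  have hcond := condSum_mul_log_le hp2 kpts t hk1
  -- `x·log p/(p−1) ≤ x`
  have hdiv : ∀ x : ℝ, 0 ≤ x → x / ((p : ℝ) - 1) * Real.log p ≤ x := by
    intro x hx
    rw [div_mul_eq_mul_div, div_le_iff₀ hpm1]
    exact mul_le_mul_of_nonneg_left hlps hx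
  have hhLb0 : (0 : ℝ) ≤ (P.hparℓ : ℝ) * P.Lbℓ := by positivity
  have ht0 : (0 : ℝ) ≤ t := Nat.cast_nonneg _
  have hkt0 : (0 : ℝ) ≤ (kpts : ℝ) * t := by positivity
  -- (a) `⌊hL_b/(p−1)⌋·log p ≤ hL_b·log p/(p−1) ≤ hL_b·ℓ ≤ 𝔘/c_L + W⋆ + G`
  have hhLb' : (P.hparℓ : ℝ) * P.Lbℓ * Real.log p ≤ P.𝔘ℓ / cLp + (P.Wstarℓ + P.Gℓ) := by rw [← hℓp]; exact hhLb
  have hA : ((P.hparℓ * P.Lbℓ / (p - 1) : ℕ) : ℝ) * Real.log p ≤ P.𝔘ℓ / cLp + (P.Wstarℓ + P.Gℓ) := by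
    have h1 : ((P.hparℓ * P.Lbℓ / (p - 1) : ℕ) : ℝ) * Real.log p ≤ (P.hparℓ : ℝ) * P.Lbℓ / ((p : ℝ) - 1) * Real.log p :=
      mul_le_mul_of_nonneg_right hc1 hlogp0
    have h2 : (P.hparℓ : ℝ) * P.Lbℓ / ((p : ℝ) - 1) * Real.log p ≤ (P.hparℓ : ℝ) * P.Lbℓ * Real.log p := by
      rw [div_mul_eq_mul_div, div_le_iff₀ hpm1]
      have h00 : (0 : ℝ) ≤ (P.hparℓ : ℝ) * P.Lbℓ * Real.log p := by positivity
      have := mul_le_mul_of_nonneg_left (show (1 : ℝ) ≤ (p : ℝ) - 1 by linarith) h00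
      linarith
    linarith
  -- (b) `⌊(t−1)/(p−1)⌋·log p ≤ t`
  have hB : (((t - 1) / (p - 1) : ℕ) : ℝ) * Real.log p ≤ t :=
    (mul_le_mul_of_nonneg_right hc2 hlogp0).trans (hdiv _ ht0)
  -- (c) the conditioning: `kpts·t·log p/(p−1) ≤ 2ᵏ𝔘/(p−1) ≤ 2ᵏ𝔘/2`, `t log(2kpts) ≤ 𝔘/128`
  have hktℓ : (kpts : ℝ) * t * Real.log p ≤ 2 ^ k * P.𝔘ℓ := by
    rw [← hℓp]
    have e : 2 ^ k * (P.𝔘ℓ / P.ℓ) * P.ℓ = 2 ^ k * P.𝔘ℓ := by field_simp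
    calc (kpts : ℝ) * t * P.ℓ ≤ 2 ^ k * (P.𝔘ℓ / P.ℓ) * P.ℓ := mul_le_mul_of_nonneg_right hKT hℓ.le
      _ = 2 ^ k * P.𝔘ℓ := e
  have hC : ((∑ j ∈ range (Nat.log p (2 * kpts)), t * (kpts / p ^ (j + 1) + 1) : ℕ) : ℝ) *
      Real.log p ≤ 2 ^ k * P.𝔘ℓ / 2 + P.𝔘ℓ / 128 := by
    refine hcond.trans ?_
    have e3 : (kpts : ℝ) * t * Real.log p / ((p : ℝ) - 1) ≤ 2 ^ k * P.𝔘ℓ / 2 := by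
      rw [div_le_iff₀ hpm1]
      have h0 : (0 : ℝ) ≤ 2 ^ k * P.𝔘ℓ := by positivity
      have := mul_le_mul_of_nonneg_left hpm2 h0
      linarith
    linarith
  have esplit : ((P.hparℓ * P.Lbℓ / (p - 1) + (t - 1) / (p - 1) +
        ∑ j ∈ range (Nat.log p (2 * kpts)), t * (kpts / p ^ (j + 1) + 1) : ℕ) : ℝ) * Real.log p =
      ((P.hparℓ * P.Lbℓ / (p - 1) : ℕ) : ℝ) * Real.log p + (((t - 1) / (p - 1) : ℕ) : ℝ) * Real.log p +
        ((∑ j ∈ range (Nat.log p (2 * kpts)), t * (kpts / p ^ (j + 1) + 1) : ℕ) : ℝ) * Real.log p := by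
    push_cast; ring
  rw [esplit]
  -- numbers: `U = 2^{d+1}𝔘 ≥ 4·2^k 𝔘`
  have h2k : (4 : ℝ) * 2 ^ k ≤ 2 ^ (d + 1) := by
    have : (2 : ℝ) ^ (k + 2) ≤ 2 ^ (d + 1) := pow_le_pow_right₀ (by norm_num) (by omega)
    calc (4 : ℝ) * 2 ^ k = 2 ^ (k + 2) := by rw [pow_add]; norm_num; ring
      _ ≤ 2 ^ (d + 1) := this
  rw [P.U_eq]
  have h2k1 : (1 : ℝ) ≤ 2 ^ k := one_le_pow₀ (by norm_num)
  have h4 : 4 * (2 ^ k * P.𝔘ℓ) ≤ 2 ^ (d + 1) * P.𝔘ℓ := by nlinarith [h2k, hU.le]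
  have h5 : P.𝔘ℓ ≤ 2 ^ k * P.𝔘ℓ := by nlinarith
  unfold cLp at hA; unfold cTp at hT
  linarith

/-- **k-step, gain branch (2)**: `hL_b·log p + log(Dmax·Mmax) < (kpts·t/2)·log p` for `J < J₀`, `k < d`,
`ℓ = log p` and any size budget `log(Dmax·Mmax) ≤ 𝔘/4 + 2ᵏ𝔘/16`: `kpts·t·log p ≥ (31/32)·2ᵏ𝔘` (`KT_ge`) and
`hL_b·log p ≤ 𝔘/c_L + W⋆ + G` (`hparLbℓ_le`). [cite: Waldschmidt1980, Lemma 3.6 (p. 272)] [cite: Yu1990, (2.31) (p. 36)] -/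
theorem kstep_ineq_two {p : ℕ} (hp : 3 ≤ p) (hℓp : P.ℓ = Real.log p) {J k : ℕ} (hJ : J < P.J₀ℓ) (_hk : k < d)
    {logDM : ℝ} (hDM : logDM ≤ P.𝔘ℓ / 4 + 2 ^ k * P.𝔘ℓ / 16) :
    ((P.hparℓ * P.Lbℓ : ℕ) : ℝ) * Real.log p + logDM <
      (((2 ^ (k + J) * P.S₀ℓ / 2) * P.tJℓ J : ℕ) : ℝ) / 2 * Real.log p := by
  have hlogp1 := one_le_log_nat hp
  have hU := P.𝔘_pos; have hW := P.one_le_Wstar; have hWU := P.Wstar_le_𝔘; have hGW := P.G_le_three_Wstar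
  have hhLb := P.hparLbℓ_le
  have hKT := P.KT_ge hJ k
  have hℓ := P.ℓ_pos
  push_cast at hKT ⊢
  have h2k1 : (1 : ℝ) ≤ 2 ^ k := one_le_pow₀ (by norm_num)
  -- `kpts·t·ℓ ≥ (31/32)·2ᵏ𝔘`
  have hKTℓ : 31 / 32 * (2 ^ k * P.𝔘ℓ) ≤ (((2 ^ (k + J) * P.S₀ℓ / 2 : ℕ) : ℝ) * (P.tJℓ J : ℝ)) * P.ℓ := by
    have e : 31 / 32 * (2 ^ k * (P.𝔘ℓ / P.ℓ)) * P.ℓ = 31 / 32 * (2 ^ k * P.𝔘ℓ) := by field_simp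
    calc 31 / 32 * (2 ^ k * P.𝔘ℓ) = 31 / 32 * (2 ^ k * (P.𝔘ℓ / P.ℓ)) * P.ℓ := e.symm
      _ ≤ (((2 ^ (k + J) * P.S₀ℓ / 2 : ℕ) : ℝ) * (P.tJℓ J : ℝ)) * P.ℓ := mul_le_mul_of_nonneg_right hKT hℓ.le
  -- `hL_b·ℓ + budget < (31/64)·2^k·𝔘`
  have h5 : P.𝔘ℓ ≤ 2 ^ k * P.𝔘ℓ := by nlinarith
  have key : (P.hparℓ : ℝ) * P.Lbℓ * P.ℓ + (P.𝔘ℓ / 4 + 2 ^ k * P.𝔘ℓ / 16) <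
      31 / 32 * (2 ^ k * P.𝔘ℓ) / 2 := by
    unfold cLp at hhLb; linarith
  rw [← hℓp]
  have h0 : (0 : ℝ) ≤ (P.hparℓ : ℝ) * P.Lbℓ := by positivity
  nlinarith [hKTℓ, key, hDM]

end PadicW80ParL

end Summit.ABC.StewartYu

end
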